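import Mathlib
import HarnessLib
import Summits.HubbardSuperconductivity.HubbardSuperconductivity.Theorems.AposterioriCapRgSsbToEvenTorusLroDoubleCommBound
import Summits.HubbardSuperconductivity.HubbardSuperconductivity.Theorems.ThermalWedgeTwApproximatingHamiltonianLocality

/-!
# Route `DeformationLadder` — crux `LowEnergyRigidity` (stmt-HubbardSuperconductivity-1892),
# crux idea `heavy-condensate-fibration`: the condensate fraction is a heavy variable

The lever of the crux idea `heavy-condensate-fibration` (Cruxes/LowEnergyRigidity/Ideas), in its
"cheapest falsifier" form: for the `d`-wave pair field `Δ = pairField dWaveFormFactor L` on the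
torus `(ℤ/Lℤ)²`, the condensate operator `Π_L = L⁻⁴ Δᴴ Δ` (whose expectation is the crux's LRO density
`⟨Δᴴ Δ⟩/L⁴`) and the Hubbard Hamiltonian `H = hubbardTorus 2 L 1 U`,

* `‖[Π_L, H]‖ = O(1)` (two volume-sized factors; see the companion file `…Fibration`), but
* `‖[Π_L, [Π_L, H]]‖ ≤ C (1 + |U|) / L²` (`hcf_norm_condensate_doubleCommutator_le`,
  `hcf_condensateIsHeavy` = the card's `CondensateIsHeavy` in quadratic-form form):
  the condensate fraction has Born–Oppenheimer mass `∝ L²`, so IMS localisation in the order parameter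
  costs `O(L⁻²)`.

Proof. With `A = Δ`, `B = Δᴴ`, `D = [A, H]`, `E = [H, B] = Dᴴ`, the exact ring identity
(`hcf_doubleCommutator_conjTranspose_mul_expand`)
`[BA, [BA, H]] = B[A,B]D + BB[A,D] + B[B,D]A - B[A,E]A - [B,E]AA + E[A,B]A`
reduces the double commutator of `R = Δᴴ Δ` to the three GRADED-LOCALITY inputs already in the tree:
`‖[Δ, Δᴴ]‖ ≤ 50 K² L²` (`twAhm_norm_comm_pairField_conjTranspose_le`), `‖[Δ, [Δ, H]]‖`,
`‖[Δᴴ, [Δ, H]]‖ ≤ 36 s²(s+2) K² J L²` (two-family Koma–Tasaki count `dcq_norm_doubleCommutator_le`),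
together with `‖Δ‖ ≤ K L²` (`norm_pairField_le`) and `‖[H, Δ]‖ ≤ 90 J K L²`
(`twAhm_norm_comm_hubbardTorusWith_pairField_le`); here `K = 2 Σ_e |d(e)/√2|`, `s = #{0,±e₁,±e₂}`,
`J = 2|t| + |U| + 2|μ|`. Every term is `O(L⁶)`, and `Π = L⁻⁴ R` gives `O(L⁻²)`. Everything is
proved for the grand-canonical `hubbardTorusWith 2 L t U μ` and an arbitrary form factor `g`, then
specialised. No cancellation `[Δ_d, Δ_d^{(2)}] = 0` is needed for the scaling (it would only improve
the `U`-dependence of the constant).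

References: Lewin–Nam–Serfaty–Solovej, CPAM 68 (2015) 413 (arXiv:1211.2778), the IMS localisation
in a heavy number-like variable; Koma–Tasaki, J. Stat. Phys. 76 (1994) 745, proof of Thm 2.2 (the
locality count).
-/

namespace Summit.HubbardSuperconductivity.HubbardSuperconductivity.Theorems

set_option linter.dupNamespace false

open Literature.MathematicalPhysics.QuantumLattice Literature.Probability.LatticeModels Matrix
open scoped Matrix.Norms.L2Operator ComplexOrder

/-! ### The ring identity behind the heavy-variable estimate -/

section Algebra

variable {R : Type*} [Ring R]

/-- **Expansion of `[BA, [BA, H]]`** in an arbitrary ring: with `D = AH - HA` and `E = HB - BH`,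
`(BA)((BA)H - H(BA)) - ((BA)H - H(BA))(BA)
  = B(AB - BA)D + BB(AD - DA) + B(BD - DB)A - B(AE - EA)A - (BE - EB)AA + E(AB - BA)A`.
Every summand contains one single commutator of `A` or `B` with `B`, `D` or `E`; for local sums
these are volume-linear, which is the whole point. [folklore] -/
theorem hcf_doubleCommutator_conjTranspose_mul_expand (A B H D E : R) (hD : D = A * H - H * A)
    (hE : E = H * B - B * H) :
    (B * A) * ((B * A) * H - H * (B * A)) - ((B * A) * H - H * (B * A)) * (B * A) =
      B * (A * B - B * A) * D + B * B * (A * D - D * A) + B * (B * D - D * B) * A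
        - B * (A * E - E * A) * A - (B * E - E * B) * A * A + E * (A * B - B * A) * A := by
  subst hD hE
  noncomm_ring

end Algebra

/-! ### Locality inputs on the torus -/

section Torus

variable (g : Site 2 → ℝ) (L : ℕ) [NeZero L]

/-- **`‖Δ [Δ, H] - [Δ, H] Δ‖ ≤ 36 s²(s+2) K² (2|t|+|U|+2|μ|) L²`** for the pair field
`Δ = pairField g L` and `H = hubbardTorusWith 2 L t U μ`: the two-family Koma–Tasaki count
`dcq_norm_doubleCommutator_le` with inner AND outer pieces the local pairs `P_y` (even, localised on
the `≤ 5` sites `y + e`, of norm `≤ K = 2 Σ_e |g e/√2|`). Stated for an arbitrary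
`DecidableEq (FermionTorus 2 L)` instance, as its twins. [cite: KomaTasaki1994, Theorem 2.2] -/
theorem hcf_norm_pairField_doubleCommutator_le (t U μ : ℝ) [inst : DecidableEq (FermionTorus 2 L)] :
    ‖pairField g L *
          (pairField g L * hubbardTorusWith 2 L t U μ - hubbardTorusWith 2 L t U μ * pairField g L) -
        (pairField g L * hubbardTorusWith 2 L t U μ - hubbardTorusWith 2 L t U μ * pairField g L) *
          pairField g L‖ ≤
      36 * ((insert (0 : Site 2) unitSteps).card : ℝ) ^ 2 * ((insert (0 : Site 2) unitSteps).card + 2) *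
        (2 * ∑ e ∈ insert (0 : Site 2) unitSteps, |g e / Real.sqrt 2|) ^ 2 *
        (2 * |t| + |U| + 2 * |μ|) * (L : ℝ) ^ 2 := by
  -- adapted from `dcq_norm_doubleCommutator_pairFieldAt_le` (outer pieces `P_y` instead of `P_yᴴ`)
  have hinst : inst = LinearOrder.toDecidableEq := Subsingleton.elim _ _
  subst hinst
  letI hdec : DecidableEq (FermionTorus 2 L) := LinearOrder.toDecidableEq
  set S : Finset (Site 2) := insert 0 unitSteps with hS_def
  set K : ℝ := 2 * ∑ e ∈ S, |g e / Real.sqrt 2| with hK_def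
  set q : TorusSite 2 L → Matrix (Finset (Orb (FermionTorus 2 L))) (Finset (Orb (FermionTorus 2 L))) ℂ :=
    fun y => localPair g L y with hq_def
  set V : TorusSite 2 L → Finset (FermionTorus 2 L) :=
    fun y => S.image fun e => FermionTorus.ofTorusSite (y + Torus.proj L e) with hV_def
  have hyV : ∀ y, FermionTorus.ofTorusSite y ∈ V y := fun y => by
    have h0 : Torus.proj L (0 : Site 2) = 0 := funext fun i => by simp
    exact Finset.mem_image.2 ⟨0, Finset.mem_insert_self _ _, by rw [h0, add_zero]⟩
  have heV : ∀ y, ∀ e ∈ S, FermionTorus.ofTorusSite (y + Torus.proj L e) ∈ V y := fun y e he =>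
    Finset.mem_image_of_mem _ he
  have hq : ∀ y, q y ∈ carEvenSubalgebra (orbSet (V y)) := fun y => by
    simp only [hq_def]
    rw [Literature.Barriers.HubbardSuperconductivity.localPair_eq_sum_bondPair]
    exact Subalgebra.sum_mem _ fun e he =>
      Subalgebra.smul_mem _ (dc_bondPair_mem_carEvenSubalgebra (hyV y) (heV y e he)) _
  have hq' : ∀ y, q y ∈ carSubalgebra (orbSet (V y)) := fun y =>
    carEvenSubalgebra_le_carSubalgebra _ (hq y)
  have hM : ∀ y, ‖q y‖ ≤ K := fun y => norm_localPair_le g L y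
  have hV : ∀ y, (V y).card ≤ S.card := fun y => Finset.card_image_le
  have hA : pairField g L = ∑ y, q y := rfl
  have key := dcq_norm_doubleCommutator_le (fermionTorusGraph 2 L) (Δ := 4) (s := S.card)
    (fun x => SourceGas.card_filter_fermionTorusGraph_adj_le x) t U μ V q q hq hq' (M := K)
    (by positivity) hM hM hV ?_
  · rw [hA, hubbardTorusWith]
    refine key.trans (le_of_eq ?_)
    rw [card_torusSite_two]
    push_cast
    ring
  · intro A
    refine (Finset.card_le_card (t := A.biUnion fun w => S.image fun e =>
      FermionTorus.toTorusSite w - Torus.proj L e) fun y hy => ?_).trans ?_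
    · rw [Finset.mem_filter] at hy
      obtain ⟨w, hwA, hwV⟩ := Finset.not_disjoint_iff.1 hy.2
      obtain ⟨e, he, hwe⟩ := Finset.mem_image.1 hwV
      refine Finset.mem_biUnion.2 ⟨w, hwA, Finset.mem_image.2 ⟨e, he, ?_⟩⟩
      rw [← hwe, FermionTorus.toTorusSite_ofTorusSite, add_sub_cancel_right]
    · calc (A.biUnion fun w => S.image fun e => FermionTorus.toTorusSite w - Torus.proj L e).card
          ≤ ∑ w ∈ A, (S.image fun e => FermionTorus.toTorusSite w - Torus.proj L e).card :=
            Finset.card_biUnion_le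
        _ ≤ ∑ _w ∈ A, S.card := Finset.sum_le_sum fun w _ => Finset.card_image_le
        _ = A.card * S.card := by rw [Finset.sum_const, smul_eq_mul]

/-- **`‖Δᴴ [Δ, H] - [Δ, H] Δᴴ‖ ≤ 36 s²(s+2) K² (2|t|+|U|+2|μ|) L²`**: the momentum-`0` case of
`dcq_norm_doubleCommutator_pairFieldAt_le` (`pairFieldAt g L 0 = pairField g L`).
[cite: KomaTasaki1994, Theorem 2.2] -/
theorem hcf_norm_pairField_conjTranspose_doubleCommutator_le (t U μ : ℝ)
    [inst : DecidableEq (FermionTorus 2 L)] :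
    ‖(pairField g L)ᴴ *
          (pairField g L * hubbardTorusWith 2 L t U μ - hubbardTorusWith 2 L t U μ * pairField g L) -
        (pairField g L * hubbardTorusWith 2 L t U μ - hubbardTorusWith 2 L t U μ * pairField g L) *
          (pairField g L)ᴴ‖ ≤
      36 * ((insert (0 : Site 2) unitSteps).card : ℝ) ^ 2 * ((insert (0 : Site 2) unitSteps).card + 2) *
        (2 * ∑ e ∈ insert (0 : Site 2) unitSteps, |g e / Real.sqrt 2|) ^ 2 *
        (2 * |t| + |U| + 2 * |μ|) * (L : ℝ) ^ 2 := by
  have h := dcq_norm_doubleCommutator_pairFieldAt_le g L t U μ 0 (inst := inst)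
  rwa [pairFieldAt_zero] at h

/-- **The heavy-variable estimate, operator-norm form.** For `R = Δᴴ Δ` (`Δ = pairField g L`) and
`H = hubbardTorusWith 2 L t U μ`,
`‖R [R, H] - [R, H] R‖ ≤ (9000 + 144 s²(s+2)) K⁴ (2|t|+|U|+2|μ|) L⁶`
(`K = 2 Σ_e |g e/√2|`, `s = #{0,±e₁,±e₂}`): the six terms of
`hcf_doubleCommutator_conjTranspose_mul_expand`, each a product of two volume-linear factors
(`‖Δ‖ ≤ K L²`, `‖[Δ,H]‖ ≤ 90 J K L²`) and one volume-linear commutator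
(`‖[Δ,Δᴴ]‖ ≤ 50 K² L²`, `‖[Δ,[Δ,H]]‖, ‖[Δᴴ,[Δ,H]]‖ ≤ 36 s²(s+2) K² J L²`).
[cite: KomaTasaki1994, Theorem 2.2] -/
theorem hcf_norm_pairDensity_doubleCommutator_le (t U μ : ℝ) [inst : DecidableEq (FermionTorus 2 L)] :
    ‖((pairField g L)ᴴ * pairField g L) *
          (((pairField g L)ᴴ * pairField g L) * hubbardTorusWith 2 L t U μ -
            hubbardTorusWith 2 L t U μ * ((pairField g L)ᴴ * pairField g L)) -
        (((pairField g L)ᴴ * pairField g L) * hubbardTorusWith 2 L t U μ -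
            hubbardTorusWith 2 L t U μ * ((pairField g L)ᴴ * pairField g L)) *
          ((pairField g L)ᴴ * pairField g L)‖ ≤
      (9000 + 144 * ((insert (0 : Site 2) unitSteps).card : ℝ) ^ 2 *
          ((insert (0 : Site 2) unitSteps).card + 2)) *
        (2 * ∑ e ∈ insert (0 : Site 2) unitSteps, |g e / Real.sqrt 2|) ^ 4 *
        (2 * |t| + |U| + 2 * |μ|) * (L : ℝ) ^ 6 := by
  set s : ℝ := ((insert (0 : Site 2) unitSteps).card : ℝ) with hs_def
  set K : ℝ := 2 * ∑ e ∈ insert (0 : Site 2) unitSteps, |g e / Real.sqrt 2| with hK_def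
  set J : ℝ := 2 * |t| + |U| + 2 * |μ| with hJ_def
  set A := pairField g L with hA_def
  set Hm := hubbardTorusWith 2 L t U μ with hHm_def
  set B := Aᴴ with hB_def
  set D := A * Hm - Hm * A with hD_def
  set E := Hm * B - B * Hm with hE_def
  have hK0 : 0 ≤ K := by positivity
  have hJ0 : 0 ≤ J := by positivity
  have hs0 : 0 ≤ s := by positivity
  have hL0 : (0 : ℝ) ≤ (L : ℝ) ^ 2 := by positivity
  have hHerm : Hmᴴ = Hm := (isHermitian_hubbardTorusWith L t U μ).eq
  have hEadj : E = Dᴴ := by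
    simp only [hE_def, hD_def, hB_def, conjTranspose_sub, conjTranspose_mul, hHerm]
  have hDadj : Eᴴ = D := by rw [hEadj, conjTranspose_conjTranspose]
  -- the volume-linear norms
  have hnA : ‖A‖ ≤ K * (L : ℝ) ^ 2 := norm_pairField_le g L
  have hnB : ‖B‖ ≤ K * (L : ℝ) ^ 2 := by rw [hB_def, l2_opNorm_conjTranspose]; exact hnA
  have hnD : ‖D‖ ≤ 90 * J * K * (L : ℝ) ^ 2 := by
    have h := twAhm_norm_comm_hubbardTorusWith_pairField_le L t U μ g
    rw [hD_def, ← norm_neg, neg_sub]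
    refine h.trans (le_of_eq ?_)
    simp only [hJ_def, hK_def]
    ring
  have hnE : ‖E‖ ≤ 90 * J * K * (L : ℝ) ^ 2 := by rw [hEadj, l2_opNorm_conjTranspose]; exact hnD
  -- the volume-linear commutators
  have hAB : ‖A * B - B * A‖ ≤ 50 * K ^ 2 * (L : ℝ) ^ 2 := by
    have h := twAhm_norm_comm_pairField_conjTranspose_le L g
    refine h.trans (le_of_eq ?_)
    simp only [hK_def]
    ring
  have hAD : ‖A * D - D * A‖ ≤ 36 * s ^ 2 * (s + 2) * K ^ 2 * J * (L : ℝ) ^ 2 :=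
    hcf_norm_pairField_doubleCommutator_le g L t U μ
  have hBD : ‖B * D - D * B‖ ≤ 36 * s ^ 2 * (s + 2) * K ^ 2 * J * (L : ℝ) ^ 2 :=
    hcf_norm_pairField_conjTranspose_doubleCommutator_le g L t U μ
  have hAE : ‖A * E - E * A‖ ≤ 36 * s ^ 2 * (s + 2) * K ^ 2 * J * (L : ℝ) ^ 2 := by
    have h1 : (A * E - E * A)ᴴ = -(B * D - D * B) := by
      simp only [conjTranspose_sub, conjTranspose_mul, hDadj, ← hB_def]
      abel
    rw [← l2_opNorm_conjTranspose, h1, norm_neg]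
    exact hBD
  have hBE : ‖B * E - E * B‖ ≤ 36 * s ^ 2 * (s + 2) * K ^ 2 * J * (L : ℝ) ^ 2 := by
    have hBadj : Bᴴ = A := by rw [hB_def, conjTranspose_conjTranspose]
    have h1 : (B * E - E * B)ᴴ = -(A * D - D * A) := by
      simp only [conjTranspose_sub, conjTranspose_mul, hDadj, hBadj]
      abel
    rw [← l2_opNorm_conjTranspose, h1, norm_neg]
    exact hAD
  -- expand and bound the six terms
  rw [hcf_doubleCommutator_conjTranspose_mul_expand A B Hm D E hD_def hE_def]
  have hc0 : 0 ≤ 36 * s ^ 2 * (s + 2) * K ^ 2 * J * (L : ℝ) ^ 2 := by positivity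
  have hT1 : ‖B * (A * B - B * A) * D‖ ≤ (K * (L : ℝ) ^ 2) * (50 * K ^ 2 * (L : ℝ) ^ 2) *
      (90 * J * K * (L : ℝ) ^ 2) :=
    calc ‖B * (A * B - B * A) * D‖ ≤ ‖B‖ * ‖A * B - B * A‖ * ‖D‖ :=
          (norm_mul_le _ _).trans (mul_le_mul_of_nonneg_right (norm_mul_le _ _) (norm_nonneg _))
      _ ≤ _ := by gcongr
  have hT2 : ‖B * B * (A * D - D * A)‖ ≤ (K * (L : ℝ) ^ 2) * (K * (L : ℝ) ^ 2) *
      (36 * s ^ 2 * (s + 2) * K ^ 2 * J * (L : ℝ) ^ 2) :=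
    calc ‖B * B * (A * D - D * A)‖ ≤ ‖B‖ * ‖B‖ * ‖A * D - D * A‖ :=
          (norm_mul_le _ _).trans (mul_le_mul_of_nonneg_right (norm_mul_le _ _) (norm_nonneg _))
      _ ≤ _ := by gcongr
  have hT3 : ‖B * (B * D - D * B) * A‖ ≤ (K * (L : ℝ) ^ 2) *
      (36 * s ^ 2 * (s + 2) * K ^ 2 * J * (L : ℝ) ^ 2) * (K * (L : ℝ) ^ 2) :=
    calc ‖B * (B * D - D * B) * A‖ ≤ ‖B‖ * ‖B * D - D * B‖ * ‖A‖ :=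
          (norm_mul_le _ _).trans (mul_le_mul_of_nonneg_right (norm_mul_le _ _) (norm_nonneg _))
      _ ≤ _ := by gcongr
  have hT4 : ‖B * (A * E - E * A) * A‖ ≤ (K * (L : ℝ) ^ 2) *
      (36 * s ^ 2 * (s + 2) * K ^ 2 * J * (L : ℝ) ^ 2) * (K * (L : ℝ) ^ 2) :=
    calc ‖B * (A * E - E * A) * A‖ ≤ ‖B‖ * ‖A * E - E * A‖ * ‖A‖ :=
          (norm_mul_le _ _).trans (mul_le_mul_of_nonneg_right (norm_mul_le _ _) (norm_nonneg _))
      _ ≤ _ := by gcongr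
  have hT5 : ‖(B * E - E * B) * A * A‖ ≤
      (36 * s ^ 2 * (s + 2) * K ^ 2 * J * (L : ℝ) ^ 2) * (K * (L : ℝ) ^ 2) * (K * (L : ℝ) ^ 2) :=
    calc ‖(B * E - E * B) * A * A‖ ≤ ‖B * E - E * B‖ * ‖A‖ * ‖A‖ :=
          (norm_mul_le _ _).trans (mul_le_mul_of_nonneg_right (norm_mul_le _ _) (norm_nonneg _))
      _ ≤ _ := by gcongr
  have hT6 : ‖E * (A * B - B * A) * A‖ ≤ (90 * J * K * (L : ℝ) ^ 2) * (50 * K ^ 2 * (L : ℝ) ^ 2) *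
      (K * (L : ℝ) ^ 2) :=
    calc ‖E * (A * B - B * A) * A‖ ≤ ‖E‖ * ‖A * B - B * A‖ * ‖A‖ :=
          (norm_mul_le _ _).trans (mul_le_mul_of_nonneg_right (norm_mul_le _ _) (norm_nonneg _))
      _ ≤ _ := by gcongr
  calc ‖B * (A * B - B * A) * D + B * B * (A * D - D * A) + B * (B * D - D * B) * A
          - B * (A * E - E * A) * A - (B * E - E * B) * A * A + E * (A * B - B * A) * A‖
      ≤ ‖B * (A * B - B * A) * D‖ + ‖B * B * (A * D - D * A)‖ + ‖B * (B * D - D * B) * A‖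
          + ‖B * (A * E - E * A) * A‖ + ‖(B * E - E * B) * A * A‖ + ‖E * (A * B - B * A) * A‖ := by
        refine (norm_add_le _ _).trans (add_le_add ?_ le_rfl)
        refine (norm_sub_le _ _).trans (add_le_add ?_ le_rfl)
        refine (norm_sub_le _ _).trans (add_le_add ?_ le_rfl)
        refine (norm_add_le _ _).trans (add_le_add ?_ le_rfl)
        exact norm_add_le _ _
    _ ≤ (K * (L : ℝ) ^ 2) * (50 * K ^ 2 * (L : ℝ) ^ 2) * (90 * J * K * (L : ℝ) ^ 2)
          + (K * (L : ℝ) ^ 2) * (K * (L : ℝ) ^ 2) * (36 * s ^ 2 * (s + 2) * K ^ 2 * J * (L : ℝ) ^ 2)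
          + (K * (L : ℝ) ^ 2) * (36 * s ^ 2 * (s + 2) * K ^ 2 * J * (L : ℝ) ^ 2) * (K * (L : ℝ) ^ 2)
          + (K * (L : ℝ) ^ 2) * (36 * s ^ 2 * (s + 2) * K ^ 2 * J * (L : ℝ) ^ 2) * (K * (L : ℝ) ^ 2)
          + (36 * s ^ 2 * (s + 2) * K ^ 2 * J * (L : ℝ) ^ 2) * (K * (L : ℝ) ^ 2) * (K * (L : ℝ) ^ 2)
          + (90 * J * K * (L : ℝ) ^ 2) * (50 * K ^ 2 * (L : ℝ) ^ 2) * (K * (L : ℝ) ^ 2) := by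
        gcongr
    _ = (9000 + 144 * s ^ 2 * (s + 2)) * K ^ 4 * J * (L : ℝ) ^ 6 := by ring

/-- Scaling of the double commutator: for a scalar `c`, `[cR, [cR, H]] = c² [R, [R, H]]`. [folklore] -/
theorem hcf_doubleCommutator_smul {n : Type*} [Fintype n] (c : ℂ) (R H : Matrix n n ℂ) :
    (c • R) * ((c • R) * H - H * (c • R)) - ((c • R) * H - H * (c • R)) * (c • R) =
      (c * c) • (R * (R * H - H * R) - (R * H - H * R) * R) := by
  simp only [smul_mul_assoc, mul_smul_comm, smul_sub, smul_smul, mul_sub, sub_mul]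

/-- **The condensate is a heavy variable, operator-norm form**: for the condensate operator
`Π = L⁻⁴ Δᴴ Δ` and `H = hubbardTorusWith 2 L t U μ`,
`‖Π [Π, H] - [Π, H] Π‖ ≤ (9000 + 144 s²(s+2)) K⁴ (2|t|+|U|+2|μ|) / L²`.
[cite: KomaTasaki1994, Theorem 2.2] -/
theorem hcf_norm_condensate_doubleCommutator_le (t U μ : ℝ) [inst : DecidableEq (FermionTorus 2 L)] :
    ‖(((1 : ℂ) / ((L : ℂ) ^ 4)) • ((pairField g L)ᴴ * pairField g L)) *
          ((((1 : ℂ) / ((L : ℂ) ^ 4)) • ((pairField g L)ᴴ * pairField g L)) * hubbardTorusWith 2 L t U μ -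
            hubbardTorusWith 2 L t U μ * (((1 : ℂ) / ((L : ℂ) ^ 4)) • ((pairField g L)ᴴ * pairField g L))) -
        ((((1 : ℂ) / ((L : ℂ) ^ 4)) • ((pairField g L)ᴴ * pairField g L)) * hubbardTorusWith 2 L t U μ -
            hubbardTorusWith 2 L t U μ * (((1 : ℂ) / ((L : ℂ) ^ 4)) • ((pairField g L)ᴴ * pairField g L))) *
          (((1 : ℂ) / ((L : ℂ) ^ 4)) • ((pairField g L)ᴴ * pairField g L))‖ ≤
      (9000 + 144 * ((insert (0 : Site 2) unitSteps).card : ℝ) ^ 2 *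
          ((insert (0 : Site 2) unitSteps).card + 2)) *
        (2 * ∑ e ∈ insert (0 : Site 2) unitSteps, |g e / Real.sqrt 2|) ^ 4 *
        (2 * |t| + |U| + 2 * |μ|) / (L : ℝ) ^ 2 := by
  rw [hcf_doubleCommutator_smul, norm_smul]
  have hL : (0 : ℝ) < (L : ℝ) := Nat.cast_pos.2 (Nat.pos_of_ne_zero (NeZero.ne L))
  have hc : ‖(1 : ℂ) / ((L : ℂ) ^ 4) * ((1 : ℂ) / ((L : ℂ) ^ 4))‖ = 1 / (L : ℝ) ^ 8 := by
    rw [norm_mul, norm_div, norm_one, norm_pow, Complex.norm_natCast]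
    field_simp
  rw [hc]
  have h := hcf_norm_pairDensity_doubleCommutator_le g L t U μ (inst := inst)
  have hL8 : (0 : ℝ) < (L : ℝ) ^ 8 := by positivity
  calc 1 / (L : ℝ) ^ 8 * ‖((pairField g L)ᴴ * pairField g L) *
            (((pairField g L)ᴴ * pairField g L) * hubbardTorusWith 2 L t U μ -
              hubbardTorusWith 2 L t U μ * ((pairField g L)ᴴ * pairField g L)) -
          (((pairField g L)ᴴ * pairField g L) * hubbardTorusWith 2 L t U μ -
              hubbardTorusWith 2 L t U μ * ((pairField g L)ᴴ * pairField g L)) *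
            ((pairField g L)ᴴ * pairField g L)‖
      ≤ 1 / (L : ℝ) ^ 8 * ((9000 + 144 * ((insert (0 : Site 2) unitSteps).card : ℝ) ^ 2 *
          ((insert (0 : Site 2) unitSteps).card + 2)) *
          (2 * ∑ e ∈ insert (0 : Site 2) unitSteps, |g e / Real.sqrt 2|) ^ 4 *
          (2 * |t| + |U| + 2 * |μ|) * (L : ℝ) ^ 6) :=
        mul_le_mul_of_nonneg_left h (by positivity)
    _ = _ := by
        field_simp

end Torus

/-! ### The card's `CondensateIsHeavy` -/

/-- **`CondensateIsHeavy`** (crux idea `heavy-condensate-fibration`, stmt-1892; the card's first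
"provable now" lemma, in its registered quadratic-form shape): there is `C` such that for every
coupling `U`, side `L` and Fock vector `φ`,
`|Re⟨φ, [Π_L, [Π_L, H_L]] φ⟩| ≤ C (1 + |U|) L⁻² ⟨φ, φ⟩`,
where `Π_L = L⁻⁴ Δᴴ Δ` (`Δ = pairField dWaveFormFactor L`, so `⟨φ, Π_L φ⟩` is the crux's `d`-wave
LRO density) and `H_L = hubbardTorus 2 L 1 U`. The condensate fraction is a HEAVY variable
(Born–Oppenheimer mass `∝ L²`): IMS localisation of `H_L` in `Π_L` costs `O(L⁻²)`, although
`‖[Π_L, H_L]‖` is of order one. From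
`hcf_norm_condensate_doubleCommutator_le` at `t = 1`, `μ = 0` and the Rayleigh bound
`|Re⟨φ, Xφ⟩| ≤ ‖X‖ ⟨φ, φ⟩`. [cite: KomaTasaki1994, Theorem 2.2] -/
theorem hcf_condensateIsHeavy :
    ∃ C : ℝ, 0 ≤ C ∧ ∀ (U : ℝ) (L : ℕ) [NeZero L] (φ : Fock (Orb (FermionTorus 2 L))),
      |(star φ ⬝ᵥ
          (((((1 : ℂ) / ((L : ℂ) ^ 4)) • ((pairField dWaveFormFactor L)ᴴ * pairField dWaveFormFactor L)) *
                ((((1 : ℂ) / ((L : ℂ) ^ 4)) •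
                      ((pairField dWaveFormFactor L)ᴴ * pairField dWaveFormFactor L)) *
                    hubbardTorus 2 L 1 U -
                  hubbardTorus 2 L 1 U *
                    (((1 : ℂ) / ((L : ℂ) ^ 4)) •
                      ((pairField dWaveFormFactor L)ᴴ * pairField dWaveFormFactor L))) -
              ((((1 : ℂ) / ((L : ℂ) ^ 4)) •
                      ((pairField dWaveFormFactor L)ᴴ * pairField dWaveFormFactor L)) *
                    hubbardTorus 2 L 1 U -
                  hubbardTorus 2 L 1 U *
                    (((1 : ℂ) / ((L : ℂ) ^ 4)) •
                      ((pairField dWaveFormFactor L)ᴴ * pairField dWaveFormFactor L))) *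
                (((1 : ℂ) / ((L : ℂ) ^ 4)) •
                  ((pairField dWaveFormFactor L)ᴴ * pairField dWaveFormFactor L))) *ᵥ φ)).re| ≤
        C * (1 + |U|) / (L : ℝ) ^ 2 * (star φ ⬝ᵥ φ).re := by
  set s : ℝ := ((insert (0 : Site 2) unitSteps).card : ℝ) with hs_def
  set K : ℝ := 2 * ∑ e ∈ insert (0 : Site 2) unitSteps, |dWaveFormFactor e / Real.sqrt 2| with hK_def
  refine ⟨2 * ((9000 + 144 * s ^ 2 * (s + 2)) * K ^ 4), by positivity, fun U L _ φ => ?_⟩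
  set P := ((1 : ℂ) / ((L : ℂ) ^ 4)) • ((pairField dWaveFormFactor L)ᴴ * pairField dWaveFormFactor L)
    with hP_def
  have hnorm : ‖P * (P * hubbardTorus 2 L 1 U - hubbardTorus 2 L 1 U * P) -
      (P * hubbardTorus 2 L 1 U - hubbardTorus 2 L 1 U * P) * P‖ ≤
      (9000 + 144 * s ^ 2 * (s + 2)) * K ^ 4 * (2 * |(1 : ℝ)| + |U| + 2 * |(0 : ℝ)|) / (L : ℝ) ^ 2 := by
    have h := hcf_norm_condensate_doubleCommutator_le dWaveFormFactor L 1 U 0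
    rw [hubbardTorusWith_zero] at h
    exact h
  have hray := abs_re_star_dotProduct_mulVec_le
    (P * (P * hubbardTorus 2 L 1 U - hubbardTorus 2 L 1 U * P) -
      (P * hubbardTorus 2 L 1 U - hubbardTorus 2 L 1 U * P) * P) φ
  have hφ : 0 ≤ (star φ ⬝ᵥ φ).re := (Complex.nonneg_iff.1 (dotProduct_star_self_nonneg φ)).1
  have hL2 : (0 : ℝ) < (L : ℝ) ^ 2 := by
    have hL : (0 : ℝ) < (L : ℝ) := Nat.cast_pos.2 (Nat.pos_of_ne_zero (NeZero.ne L))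
    positivity
  have hJ : 2 * |(1 : ℝ)| + |U| + 2 * |(0 : ℝ)| ≤ 2 * (1 + |U|) := by
    rw [abs_one, abs_zero]
    linarith [abs_nonneg U]
  have hC0 : 0 ≤ (9000 + 144 * s ^ 2 * (s + 2)) * K ^ 4 := by positivity
  calc |(star φ ⬝ᵥ ((P * (P * hubbardTorus 2 L 1 U - hubbardTorus 2 L 1 U * P) -
          (P * hubbardTorus 2 L 1 U - hubbardTorus 2 L 1 U * P) * P) *ᵥ φ)).re|
      ≤ ‖P * (P * hubbardTorus 2 L 1 U - hubbardTorus 2 L 1 U * P) -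
          (P * hubbardTorus 2 L 1 U - hubbardTorus 2 L 1 U * P) * P‖ * (star φ ⬝ᵥ φ).re := hray
    _ ≤ (9000 + 144 * s ^ 2 * (s + 2)) * K ^ 4 * (2 * |(1 : ℝ)| + |U| + 2 * |(0 : ℝ)|) / (L : ℝ) ^ 2 *
          (star φ ⬝ᵥ φ).re := mul_le_mul_of_nonneg_right hnorm hφ
    _ ≤ (9000 + 144 * s ^ 2 * (s + 2)) * K ^ 4 * (2 * (1 + |U|)) / (L : ℝ) ^ 2 *
          (star φ ⬝ᵥ φ).re := by
        refine mul_le_mul_of_nonneg_right ?_ hφ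
        refine div_le_div_of_nonneg_right ?_ hL2.le
        exact mul_le_mul_of_nonneg_left hJ hC0
    _ = 2 * ((9000 + 144 * s ^ 2 * (s + 2)) * K ^ 4) * (1 + |U|) / (L : ℝ) ^ 2 *
          (star φ ⬝ᵥ φ).re := by ring

end Summit.HubbardSuperconductivity.HubbardSuperconductivity.Theorems
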